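import Literature.Topology.FourManifolds.CollarReparamCalculus
import Literature.Geometry.Lorentzian.Hypersurface
import Literature.Geometry.Lorentzian.ProductMetric
import Literature.Geometry.Riemannian.RoundSphere
import HarnessLib

/-!
# The warped seam metric `a(z, t) dt² + F(z, t) h_z` on `N × ℝ`

Support file (everything proved, no definitions, no named facts) for the τ-equivariant collar
gluing of two umbilic collared metrics (stub `stub_collarGluing` of crux `CorkRegluablePsc`,
item stmt-SmoothPoincare4-3206).  On the seam tube `∂C × ℝ` of the three-piece gluing
`C ∪_φ W` the glued metric is, in the coordinate `s = tanh t`, the warped product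
`ε² (1 - tanh² t)² dt² + (1 - 2 μ(z) ε tanh t - C₀ ε² tanh² t) h_z` (Bär–Hanke 2023, §3,
Def. 21 and Cor. 34: `C`-normal metrics `dt² + g_t` glue across a doubling seam).  This file
builds such metrics abstractly:

* `isSpacelikeImmersion_of_isRiemannian` — for a Riemannian metric every smooth embedding is a
  spacelike immersion (the induced form is positive definite), so that the boundary metric
  `h = incl^* g` is a Riemannian metric on `∂C` (`PseudoRiemannianMetric.inducedMetric`,
  O'Neill 1983, Ch. 4, p. 97);
* `exists_warpedSeamMetric` — for a Riemannian metric `h` on `N` and smooth positive functions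
  `a`, `F` on `N × ℝ` there is a smooth Riemannian metric `G` on `N × ℝ` (model
  `I'.prod 𝓘(ℝ, ℝ)`) with `G_{(z,t)}((v₁,v₂),(w₁,w₂)) = a(z,t) v₂ w₂ + F(z,t) h_z(v₁,w₁)`
  (`G = a · pr₂^* dt² + F · pr₁^* h`, O'Neill 1983, Ch. 3, Lemma 3.5 and Ch. 7, Def. 7.33
  (warped products));
* `warpedSeam_val_prodMap` — `G` is invariant under `Φ × id` for every `Φ` preserving `h`, `a`
  and `F` (the isometric involution `τ × id` of the seam tube).

## References

* B. O'Neill, *Semi-Riemannian Geometry* (1983), Ch. 3, Lemma 3.5; Ch. 4, p. 97; Ch. 7,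
  Def. 7.33. [ONeill1983]
* C. Bär, B. Hanke, *Boundary conditions for scalar curvature* (2023), §3, Def. 21, Cor. 34.
  [BarHanke2023]
-/

noncomputable section

open Bundle Set Function Filter
open scoped Manifold ContDiff Topology

namespace Literature.Geometry.Riemannian

open Literature.Geometry.Lorentzian Literature.Geometry.Lorentzian.PseudoRiemannianMetric
  Literature.Topology.FourManifolds

/-! ### Smooth embeddings are spacelike for Riemannian metrics -/

section Spacelike

variable {E : Type*} [NormedAddCommGroup E] [NormedSpace ℝ E] {H : Type*} [TopologicalSpace H]
  {I : ModelWithCorners ℝ E H} {M : Type*} [TopologicalSpace M] [ChartedSpace H M]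
  [IsManifold I ∞ M]
  {E' : Type*} [NormedAddCommGroup E'] [NormedSpace ℝ E'] {H' : Type*} [TopologicalSpace H']
  {I' : ModelWithCorners ℝ E' H'} {N : Type*} [TopologicalSpace N] [ChartedSpace H' N]

/-- **For a Riemannian metric every smooth embedding is a spacelike immersion**: `f^* g` is
positive definite because `df` is injective (`injective_mfderiv_of_isSmoothEmbedding`).
[cite: ONeill1983, Ch. 4, p. 97] -/
theorem isSpacelikeImmersion_of_isRiemannian [Nonempty N]
    {g : PseudoRiemannianMetric I ∞ E (TangentSpace I : M → Type _)} (hg : g.IsRiemannian)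
    {f : N → M} (hf : Manifold.IsSmoothEmbedding I' I ∞ f) : g.IsSpacelikeImmersion I' f := by
  refine ⟨?_, fun y v hv ↦ ?_⟩
  · have h : ((∞ : ℕ∞ω) + 1) = ∞ := rfl
    rw [h]
    exact hf.contMDiff
  · rw [inducedBilin_apply]
    refine hg (f y) _ fun h0 ↦ hv ?_
    exact injective_mfderiv_of_isSmoothEmbedding hf (by simp) y (by rw [map_zero]; exact h0)

end Spacelike

/-! ### The warped seam metric -/

section Warped

variable {E' : Type*} [NormedAddCommGroup E'] [NormedSpace ℝ E'] {H' : Type*} [TopologicalSpace H']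
  {I' : ModelWithCorners ℝ E' H'} {N : Type*} [TopologicalSpace N] [ChartedSpace H' N]
  [IsManifold I' ∞ N]

/-- `(pr₁^* h)_{(z,t)}(v, w) = h_z(v₁, w₁)`. [cite: ONeill1983, Ch. 3, Lemma 3.5 (p. 57)] -/
theorem pullbackBilin_fst_apply (hN : PseudoRiemannianMetric I' ∞ E' (TangentSpace I' : N → Type _))
    (p : N × ℝ) (v w : TangentSpace (I'.prod 𝓘(ℝ, ℝ)) p) :
    pullbackBilin (I := I') (I' := I'.prod 𝓘(ℝ, ℝ)) (Prod.fst : N × ℝ → N) hN.val p v w =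
      hN.val p.1 v.1 w.1 := by
  obtain ⟨z, t⟩ := p
  rw [pullbackBilin_apply, mfderiv_fst]
  rfl

omit [IsManifold I' ∞ N] in
/-- `(pr₂^* dt²)_{(z,t)}(v, w) = v₂ w₂`. [cite: ONeill1983, Ch. 3, Lemma 3.5 (p. 57)] -/
theorem pullbackBilin_snd_euclidean_apply (p : N × ℝ) (v w : TangentSpace (I'.prod 𝓘(ℝ, ℝ)) p) :
    pullbackBilin (I := 𝓘(ℝ, ℝ)) (I' := I'.prod 𝓘(ℝ, ℝ)) (Prod.snd : N × ℝ → ℝ)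
      (euclideanMetric ℝ).val p v w = v.2 * w.2 := by
  obtain ⟨z, t⟩ := p
  rw [pullbackBilin_apply, mfderiv_snd, euclideanMetric_apply]
  exact mul_comm w.2 v.2

/-- **The warped seam metric.** For a Riemannian metric `h` on `N` and smooth positive functions
`a`, `F` on `N × ℝ` there is a smooth Riemannian metric `G` on `N × ℝ` with
`G_{(z,t)}((v₁,v₂),(w₁,w₂)) = a(z,t) v₂ w₂ + F(z,t) h_z(v₁,w₁)`, namely
`G = a · pr₂^* dt² + F · pr₁^* h` (smooth as a section by `contMDiff_pullbackBilin_holds` and the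
algebra of smooth sections; positive definite since `a, F > 0` and `h` is Riemannian).
[cite: ONeill1983, Ch. 7, Def. 7.33] -/
theorem exists_warpedSeamMetric (hN : PseudoRiemannianMetric I' ∞ E' (TangentSpace I' : N → Type _))
    (hpos : hN.IsRiemannian) {a F : N × ℝ → ℝ} (ha : ContMDiff (I'.prod 𝓘(ℝ, ℝ)) 𝓘(ℝ, ℝ) ∞ a)
    (hF : ContMDiff (I'.prod 𝓘(ℝ, ℝ)) 𝓘(ℝ, ℝ) ∞ F) (ha0 : ∀ p, 0 < a p) (hF0 : ∀ p, 0 < F p) :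
    ∃ G : PseudoRiemannianMetric (I'.prod 𝓘(ℝ, ℝ)) ∞ (E' × ℝ)
        (TangentSpace (I'.prod 𝓘(ℝ, ℝ)) : N × ℝ → Type _),
      G.IsRiemannian ∧ ∀ (p : N × ℝ) (v w : TangentSpace (I'.prod 𝓘(ℝ, ℝ)) p),
        G.val p v w = a p * (v.2 * w.2) + F p * hN.val p.1 v.1 w.1 := by
  -- the two pulled-back fields
  set S₁ : Π p : N × ℝ, TangentSpace (I'.prod 𝓘(ℝ, ℝ)) p →L[ℝ]
      TangentSpace (I'.prod 𝓘(ℝ, ℝ)) p →L[ℝ] ℝ :=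
    fun p ↦ pullbackBilin (I := I') (I' := I'.prod 𝓘(ℝ, ℝ)) (Prod.fst : N × ℝ → N) hN.val p with hS₁
  set S₂ : Π p : N × ℝ, TangentSpace (I'.prod 𝓘(ℝ, ℝ)) p →L[ℝ]
      TangentSpace (I'.prod 𝓘(ℝ, ℝ)) p →L[ℝ] ℝ :=
    fun p ↦ pullbackBilin (I := 𝓘(ℝ, ℝ)) (I' := I'.prod 𝓘(ℝ, ℝ)) (Prod.snd : N × ℝ → ℝ)
      (euclideanMetric ℝ).val p with hS₂
  have h1s := contMDiff_pullbackBilin_holds (I := I') (I' := I'.prod 𝓘(ℝ, ℝ)) (M := N)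
    (N := N × ℝ) (n := ∞) (Prod.fst : N × ℝ → N) contMDiff_fst hN
  have h2s := contMDiff_pullbackBilin_holds (I := 𝓘(ℝ, ℝ)) (I' := I'.prod 𝓘(ℝ, ℝ)) (M := ℝ)
    (N := N × ℝ) (n := ∞) (Prod.snd : N × ℝ → ℝ) contMDiff_snd (euclideanMetric ℝ)
  set val : Π p : N × ℝ, TangentSpace (I'.prod 𝓘(ℝ, ℝ)) p →L[ℝ]
      TangentSpace (I'.prod 𝓘(ℝ, ℝ)) p →L[ℝ] ℝ := fun p ↦ a p • S₂ p + F p • S₁ p with hval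
  have hvapply : ∀ (p : N × ℝ) (v w : TangentSpace (I'.prod 𝓘(ℝ, ℝ)) p),
      val p v w = a p * (v.2 * w.2) + F p * hN.val p.1 v.1 w.1 := fun p v w ↦ by
    simp only [hval, hS₁, hS₂, _root_.add_apply, _root_.smul_apply, smul_eq_mul]
    rw [pullbackBilin_fst_apply, pullbackBilin_snd_euclidean_apply]
  -- positivity
  have hvpos : ∀ (p : N × ℝ) (v : TangentSpace (I'.prod 𝓘(ℝ, ℝ)) p), v ≠ 0 → 0 < val p v v := by
    intro p v hv
    rw [hvapply]
    have h1 : 0 ≤ a p * (v.2 * v.2) := mul_nonneg (ha0 p).le (mul_self_nonneg _)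
    have h2 : 0 ≤ F p * hN.val p.1 v.1 v.1 := by
      by_cases h0 : v.1 = 0
      · have hz : hN.val p.1 v.1 v.1 = 0 := by rw [h0]; exact (hN.val p.1 0).map_zero
        rw [hz, mul_zero]
      · exact mul_nonneg (hF0 p).le (hpos p.1 v.1 h0).le
    by_cases h0 : v.1 = 0
    · have h2' : v.2 ≠ 0 := fun h' ↦ hv (Prod.ext h0 h')
      have : 0 < a p * (v.2 * v.2) := mul_pos (ha0 p) (mul_self_pos.2 h2')
      linarith
    · have : 0 < F p * hN.val p.1 v.1 v.1 := mul_pos (hF0 p) (hpos p.1 v.1 h0)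
      linarith
  -- smoothness
  have hsmooth : ContMDiff (I'.prod 𝓘(ℝ, ℝ))
      ((I'.prod 𝓘(ℝ, ℝ)).prod 𝓘(ℝ, (E' × ℝ) →L[ℝ] (E' × ℝ) →L[ℝ] ℝ)) ∞
      (fun q : N × ℝ ↦ TotalSpace.mk' ((E' × ℝ) →L[ℝ] (E' × ℝ) →L[ℝ] ℝ)
        (E := fun q : N × ℝ ↦ TangentSpace (I'.prod 𝓘(ℝ, ℝ)) q →L[ℝ]
          TangentSpace (I'.prod 𝓘(ℝ, ℝ)) q →L[ℝ] ℝ) q (val q)) := fun p ↦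
    ((ha p).smul_section (h2s p)).add_section ((hF p).smul_section (h1s p))
  refine ⟨⟨val, fun p v w ↦ ?_, fun p v hv ↦ ?_, hsmooth⟩, fun p v hv ↦ hvpos p v hv,
    fun p v w ↦ hvapply p v w⟩
  · -- symmetry
    rw [hvapply, hvapply, hN.symm p.1 v.1 w.1, mul_comm v.2 w.2]
  · -- nondegeneracy
    by_contra h0
    exact (hvpos p v h0).ne' (hv v)

/-- **Invariance of the warped seam metric under `Φ × id`.** If `G` is the warped seam metric of
`(h, a, F)` and `Φ : N → N` is differentiable at `z` with `(Φ^* h)_z = h_z`,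
`a(Φ z, t) = a(z, t)`, `F(Φ z, t) = F(z, t)`, then `((Φ × id)^* G)_{(z,t)} = G_{(z,t)}`
(so `τ × id` is an isometry of the seam tube when `τ^* h = h` and `a`, `F` are `τ`-invariant).
[cite: ONeill1983, Ch. 3, p. 58] -/
theorem warpedSeam_val_prodMap
    {G : PseudoRiemannianMetric (I'.prod 𝓘(ℝ, ℝ)) ∞ (E' × ℝ)
      (TangentSpace (I'.prod 𝓘(ℝ, ℝ)) : N × ℝ → Type _)}
    {hN : PseudoRiemannianMetric I' ∞ E' (TangentSpace I' : N → Type _)} {a F : N × ℝ → ℝ}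
    (hG : ∀ (p : N × ℝ) (v w : TangentSpace (I'.prod 𝓘(ℝ, ℝ)) p),
      G.val p v w = a p * (v.2 * w.2) + F p * hN.val p.1 v.1 w.1)
    {Φ : N → N} {p : N × ℝ} (hΦ : MDifferentiableAt I' I' Φ p.1)
    (hh : pullbackBilin (I := I') (I' := I') Φ hN.val p.1 = hN.val p.1)
    (haΦ : a (Φ p.1, p.2) = a p) (hFΦ : F (Φ p.1, p.2) = F p)
    (v w : TangentSpace (I'.prod 𝓘(ℝ, ℝ)) p) :
    pullbackBilin (I := I'.prod 𝓘(ℝ, ℝ)) (I' := I'.prod 𝓘(ℝ, ℝ)) (Prod.map Φ id) G.val p v w =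
      G.val p v w := by
  have hD : HasMFDerivAt (I'.prod 𝓘(ℝ, ℝ)) (I'.prod 𝓘(ℝ, ℝ)) (Prod.map Φ id) p
      (((mfderiv I' I' Φ p.1).comp
        (ContinuousLinearMap.fst ℝ (TangentSpace I' p.1) (TangentSpace 𝓘(ℝ, ℝ) p.2))).prod
        (ContinuousLinearMap.snd ℝ (TangentSpace I' p.1) (TangentSpace 𝓘(ℝ, ℝ) p.2))) :=
    (hΦ.hasMFDerivAt.comp p (hasMFDerivAt_fst p)).prodMk (hasMFDerivAt_snd p)
  rw [pullbackBilin_apply, hD.mfderiv]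
  have hpt : Prod.map Φ id p = (Φ p.1, p.2) := rfl
  rw [hpt, hG, hG]
  have hh' : ∀ v₁ w₁ : TangentSpace I' p.1, hN.val (Φ p.1) (mfderiv I' I' Φ p.1 v₁)
      (mfderiv I' I' Φ p.1 w₁) = hN.val p.1 v₁ w₁ := fun v₁ w₁ ↦ by
    have h := DFunLike.congr_fun (DFunLike.congr_fun hh v₁) w₁
    rw [pullbackBilin_apply] at h
    exact h
  show a (Φ p.1, p.2) * (v.2 * w.2) + F (Φ p.1, p.2) *
      hN.val (Φ p.1) (mfderiv I' I' Φ p.1 v.1) (mfderiv I' I' Φ p.1 w.1) = _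
  rw [haΦ, hFΦ, hh']

end Warped

end Literature.Geometry.Riemannian
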